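import Mathlib.RingTheory.Flat.Localization
import Mathlib.Algebra.Ring.Action.Submonoid
import Literature.NumberTheory.EllipticCurves.TateModuleFinite
import Literature.AlgebraicGeometry.Motives.FaltingsECSemisimpleProofs
import Literature.NumberTheory.EllipticCurves.TateModuleFinrankProofs
import Literature.NumberTheory.EllipticCurves.HasseWeilAbelian
import HarnessLib

/-!
# Inertia invariants of `V_ℓ E` via the Tate module of the fixed points

Sibling proof file (theorems only) of `TateModule` / `HasseWeilAbelian`, serving the tame part of
the conductor (Silverman, *ATAEC*, Thm. IV.10.2(a); in the tree the named facts
`WeierstrassCurve.codimFixed_inertia_rationalTate_eq_one_of_hasMultiplicativeReductionAt` and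
`WeierstrassCurve.codimFixed_inertia_rationalTate_eq_two_of_hasAdditiveReductionAt` of
`HasseWeilAbelianConductor`, on which `Literature.NumberTheory.EllipticCurves.conductor_eq_conductorOf_mul` rests through the
C15 fact `artinConductorExponent_tate_eq_conductorExponent_of_isElliptic`).

The printed proof of 10.2(a) (PDF p. 359 of the held copy) is pure Tate-module algebra on top of
three geometric inputs (`E(K^nr)/E₀(K^nr)` finite, IV.9.2(d); `E₁(K^nr)` has no `ℓ`-torsion,
AEC VII.3.1; `E₀/E₁ ≅ Ẽ_ns(k̄)`, AEC VII.2.1, VII.5.1).  This file proves the algebra, for an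
arbitrary abelian group `A` with an action of a group `G`, a subgroup `H ≤ G` and a prime `p`:

* *"We observe that `V_ℓ(A)` will be `0` if `A` has no `ℓ`-torsion, or if `A` is a finite
  group"* (p. 359): `TateModule.eq_zero_of_forall_pow_smul_eq_zero`,
  `TateModule.finrank_eq_zero_of_finite` (`T_p A = 0` as soon as the `p`-power torsion of `A` has
  bounded exponent, e.g. is finite);
* *"we clearly have `V_ℓ(E(K^nr)) = V_ℓ(E(K̄))^{G(K̄/K^nr)}`"* (p. 359): the `H`-invariants of
  `V_p A = ℚ_p ⊗ T_p A` are the image of `V_p(A^H)` under the (injective) base change of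
  `T_p(A^H ↪ A)` — `TateModule.mem_range_map_fixedPoints_subtype_iff` (`(T_p A)^H = T_p(A^H)`),
  `RationalTateModule.forall_rationalTateRepresentation_eq_iff` (denominators may be cleared,
  `RationalTateModule.exists_smul_eq_toRational` of `FaltingsECSemisimpleProofs`, because `T_p A`
  is torsion-free, `TateModule.toRational_injective`), and
  `RationalTateModule.finrank_invariants_rationalTateRepresentation`:
  `dim_{ℚ_p} (V_p A)^H = rank_{ℤ_p} T_p(A^H)` when `A[p]` is finite;
* *"`ε(E/K) = 2 - dim_{ℚ_ℓ}(V_ℓ(E)^{I(K̄/K)})`"* (p. 359): for an elliptic curve `E/F`, a prime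
  `ℓ ≠ char F` and any subgroup `H ≤ Γ_F`,
  `codim (V_ℓ E)^H = 2 - rank_{ℤ_ℓ} T_ℓ(E(F̄)^H)` (`WeierstrassCurve.codimFixed_rationalTate_eq_two_sub`,
  with `rank T_ℓ(E(F̄)^H) ≤ 2`), hence `codim (V_ℓ E)^H = 2` as soon as the `ℓ`-power torsion of
  `E(F̄)^H` is finite (`WeierstrassCurve.codimFixed_rationalTate_eq_two_of_finite`) and
  `codim (V_ℓ E)^H = 1 ↔ rank T_ℓ(E(F̄)^H) = 1` (`…_eq_one_iff`).  For a number field `K` and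
  `H = I_𝔓` the inertia group of a prime `𝔓` of `\bar ℤ_K` this is the shape of the two named
  facts above: the additive case is thereby reduced to the finiteness of the `ℓ`-power torsion of
  `E(K̄)^{I_𝔓}` (`= E(K_v^nr)[ℓ^∞] ↪ E(K_v^nr)/E₀(K_v^nr)`, Silverman IV.9.2(d)), the
  multiplicative case to `rank T_ℓ(E(K̄)^{I_𝔓}) = 1`
  (`WeierstrassCurve.codimFixed_inertia_rationalTate_eq_two_of_finite`,
  `WeierstrassCurve.codimFixed_inertia_rationalTate_eq_one_of_finrank_eq_one`).

No new definitions: the fixed points are Mathlib's `FixedPoints.addSubgroup H A`, the invariants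
Mathlib's `Representation.invariants` of the restriction to `H` (definitionally the tree's
`ContinuousRep.fixedSubmodule`).

## References

* J. H. Silverman, *Advanced Topics in the Arithmetic of Elliptic Curves*, GTM 151 (1994), §IV.10,
  proof of Thm. 10.2(a), PDF p. 359. [SilvermanATAEC1994]
* J.-P. Serre, J. Tate, *Good reduction of abelian varieties*, Ann. of Math. 88 (1968), §1
  (the source of that proof, loc. cit.). [SerreTate1968]
* J. H. Silverman, *The Arithmetic of Elliptic Curves*, 2nd ed. (2009), III.§7 (Tate module),
  Prop. III.7.1. [SilvermanAEC2009]
-/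

noncomputable section

open scoped Classical AddSubgroup TensorProduct NumberField
open Field IsDedekindDomain

universe u v

namespace Literature.NumberTheory.EllipticCurves

/-! ### `T_p` of a subgroup and of the fixed points -/

namespace TateModule

variable {A : Type u} [AddCommGroup A] {p : ℕ} [Fact p.Prime]

/-- `T_p` is left exact: an injective `f : A →+ B` induces an injective `T_p f`.
Silverman, *AEC*, III.§7. [folklore] -/
theorem map_injective_of_injective {B : Type v} [AddCommGroup B] (f : A →+ B)
    (hf : Function.Injective f) : Function.Injective (map p f) := fun x y hxy ↦
  TateModule.ext fun n ↦ hf (by rw [← proj_map, ← proj_map, hxy])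

/-- `T_p B ⊆ T_p A` for a subgroup `B ≤ A` consists of the compatible sequences with all
components in `B`. Silverman, *AEC*, III.§7. [folklore] -/
theorem mem_range_map_subtype_iff (B : AddSubgroup A) (x : TateModule A p) :
    x ∈ LinearMap.range (map p B.subtype) ↔ ∀ n, proj p n x ∈ B := by
  constructor
  · rintro ⟨y, rfl⟩ n
    rw [proj_map]
    exact (proj p n y).2
  · intro hx
    refine ⟨mk (fun n ↦ ⟨proj p n x, hx n⟩) (fun n ↦ Subtype.ext ?_) (fun n ↦ Subtype.ext ?_),
      TateModule.ext fun n ↦ ?_⟩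
    · simp only [AddSubgroup.coe_nsmul, AddSubgroup.coe_zero]
      exact pow_smul_proj n x
    · simp only [AddSubgroup.coe_nsmul]
      exact smul_proj_succ n x
    · rw [proj_map, proj_mk]
      rfl

omit [Fact p.Prime] in
/-- **`T_p A = 0` if the `p`-power torsion of `A` has bounded exponent** (`p ^ m` kills every
`p`-power torsion element): then `a_n = p ^ m • a_{n+m} = 0` for every `(a_n) ∈ T_p A`.  This is
Silverman's remark *"`V_ℓ(A)` will be `0` if `A` has no `ℓ`-torsion, or if `A` is a finite group"*
(*ATAEC*, proof of IV.10.2(a), PDF p. 359), already for `T_ℓ`.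
[cite: SilvermanATAEC1994, proof of Thm. IV.10.2(a), PDF p. 359] -/
theorem eq_zero_of_forall_pow_smul_eq_zero {m : ℕ}
    (hA : ∀ a : A, ∀ n : ℕ, p ^ n • a = 0 → p ^ m • a = 0) (x : TateModule A p) : x = 0 := by
  refine TateModule.ext fun n ↦ ?_
  rw [_root_.map_zero, ← pow_smul_proj_self_add m n x]
  exact hA _ (m + n) (pow_smul_proj (m + n) x)

omit [Fact p.Prime] in
/-- `T_p A` is trivial if the `p`-power torsion of `A` has bounded exponent.
[cite: SilvermanATAEC1994, proof of Thm. IV.10.2(a), PDF p. 359] -/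
theorem subsingleton_of_forall_pow_smul_eq_zero {m : ℕ}
    (hA : ∀ a : A, ∀ n : ℕ, p ^ n • a = 0 → p ^ m • a = 0) : Subsingleton (TateModule A p) :=
  ⟨fun x y ↦ by rw [eq_zero_of_forall_pow_smul_eq_zero hA x, eq_zero_of_forall_pow_smul_eq_zero hA y]⟩

omit [Fact p.Prime] in
/-- A finite `p`-power torsion subgroup has bounded exponent. [folklore] -/
theorem exists_forall_pow_smul_eq_zero_of_finite
    (hfin : {a : A | ∃ n : ℕ, p ^ n • a = 0}.Finite) :
    ∃ m : ℕ, ∀ a : A, ∀ n : ℕ, p ^ n • a = 0 → p ^ m • a = 0 := by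
  have key : ∀ a ∈ hfin.toFinset, ∃ n : ℕ, p ^ n • a = 0 := fun a ha ↦ by
    simpa using ha
  choose! f hf using key
  refine ⟨hfin.toFinset.sup f, fun a n han ↦ ?_⟩
  have ha : a ∈ hfin.toFinset := by simpa using ⟨n, han⟩
  obtain ⟨k, hk⟩ := Nat.exists_eq_add_of_le' (Finset.le_sup (f := f) ha)
  rw [hk, pow_add, mul_smul, hf a ha, smul_zero]

/-- **`rank_{ℤ_p} T_p A = 0` if the `p`-power torsion of `A` is finite** (*"`V_ℓ(A)` will be `0`
… if `A` is a finite group"*, Silverman *ATAEC* p. 359).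
[cite: SilvermanATAEC1994, proof of Thm. IV.10.2(a), PDF p. 359] -/
theorem finrank_eq_zero_of_finite (hfin : {a : A | ∃ n : ℕ, p ^ n • a = 0}.Finite) :
    Module.finrank ℤ_[p] (TateModule A p) = 0 := by
  obtain ⟨m, hm⟩ := exists_forall_pow_smul_eq_zero_of_finite hfin
  haveI := subsingleton_of_forall_pow_smul_eq_zero hm
  exact Module.finrank_zero_of_subsingleton

/-- **`T_p A ↪ V_p A`**: the canonical map `x ↦ 1 ⊗ x` is injective, `T_p A` being torsion-free
(`TateModule.instIsTorsionFree`), hence flat, over the discrete valuation ring `ℤ_p`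
(`ℤ_p ↪ ℚ_p` stays injective after `- ⊗ T_p A`).  Serre (1968), I.1.1. [folklore] -/
theorem toRational_injective :
    Function.Injective (TateModule.toRational p (A := A)) := by
  have h1 : Function.Injective ((Algebra.linearMap ℤ_[p] ℚ_[p]).rTensor (TateModule A p)) :=
    Module.Flat.rTensor_preserves_injective_linearMap _ (IsFractionRing.injective ℤ_[p] ℚ_[p])
  have h2 : (TateModule.toRational p (A := A) : TateModule A p → RationalTateModule A p) =
      (Algebra.linearMap ℤ_[p] ℚ_[p]).rTensor (TateModule A p) ∘
        (TensorProduct.lid ℤ_[p] (TateModule A p)).symm := by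
    ext x
    simp [TateModule.toRational_apply, LinearMap.rTensor_tmul]
  rw [h2]
  exact h1.comp (TensorProduct.lid ℤ_[p] (TateModule A p)).symm.injective

variable {G : Type*} [Group G] [DistribMulAction G A]

/-- **`(T_p A)^H = T_p(A^H)`**: an element of `T_p A` is fixed by the subgroup `H ≤ G` iff it
lies in (the image of) the Tate module of the fixed points `A^H = FixedPoints.addSubgroup H A`.
This is the integral form of *"we clearly have `V_ℓ(E(K^nr)) = V_ℓ(E(K̄))^{G(K̄/K^nr)}`"*
(Silverman *ATAEC*, proof of IV.10.2(a), PDF p. 359, with `H = G(K̄/K^nr) = I(K̄/K)`).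
[cite: SilvermanATAEC1994, proof of Thm. IV.10.2(a), PDF p. 359] -/
theorem mem_range_map_fixedPoints_subtype_iff (H : Subgroup G) (x : TateModule A p) :
    x ∈ LinearMap.range (map p (FixedPoints.addSubgroup H A).subtype) ↔ ∀ g ∈ H, g • x = x := by
  rw [mem_range_map_subtype_iff]
  simp only [FixedPoints.mem_addSubgroup, Subtype.forall, Subgroup.mk_smul, TateModule.ext_iff,
    proj_smul_of_distribMulAction]
  exact forall_comm.trans (forall_congr' fun g ↦ forall_comm)

end TateModule

/-! ### Invariants of `V_p A` -/

namespace RationalTateModule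

variable {A : Type u} [AddCommGroup A] {p : ℕ} [Fact p.Prime]

variable {G : Type*} [Group G] [DistribMulAction G A]

/-- The base change `V_p(A^H) → V_p A` of `T_p(A^H ↪ A)` lands in the `H`-invariants of the
rational Tate representation. [folklore] -/
theorem rationalTateRepresentation_baseChange_map_fixedPoints (H : Subgroup G) {g : G} (hg : g ∈ H)
    (w : ℚ_[p] ⊗[ℤ_[p]] TateModule (FixedPoints.addSubgroup H A) p) :
    rationalTateRepresentation G A p g
      (((TateModule.map p (FixedPoints.addSubgroup H A).subtype).baseChange ℚ_[p] w
        : ℚ_[p] ⊗[ℤ_[p]] TateModule A p) : RationalTateModule A p) =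
      (TateModule.map p (FixedPoints.addSubgroup H A).subtype).baseChange ℚ_[p] w := by
  induction w using TensorProduct.induction_on with
  | zero => rw [_root_.map_zero]; exact _root_.map_zero _
  | tmul c y =>
    have hy : g • TateModule.map p (FixedPoints.addSubgroup H A).subtype y =
        TateModule.map p (FixedPoints.addSubgroup H A).subtype y :=
      (TateModule.mem_range_map_fixedPoints_subtype_iff H _).mp ⟨y, rfl⟩ g hg
    rw [LinearMap.baseChange_tmul, rationalTateRepresentation_apply_tmul, hy]
  | add v w hv hw =>
    rw [map_add]
    exact (map_add _ _ _).trans (by rw [hv, hw]; rfl)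

/-- **The `H`-invariants of `V_p A` are `V_p(A^H)`.**  A vector `v ∈ V_p A` is fixed by the
subgroup `H ≤ G` iff it is in the image of `V_p(A^H) = ℚ_p ⊗ T_p(A^H)` under the base change of
`T_p(A^H ↪ A)`: clear denominators (`exists_smul_eq_toRational`), observe that the lattice
point obtained is `H`-fixed because `T_p A ↪ V_p A` (`TateModule.toRational_injective`), and use
`(T_p A)^H = T_p(A^H)` (`TateModule.mem_range_map_fixedPoints_subtype_iff`).  This is
*"`V_ℓ(E(K^nr)) = V_ℓ(E(K̄))^{G(K̄/K^nr)} = V_ℓ(E(K̄))^{I(K̄/K)}`"* of Silverman *ATAEC*, proof of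
IV.10.2(a), PDF p. 359, for a general group action.
[cite: SilvermanATAEC1994, proof of Thm. IV.10.2(a), PDF p. 359] -/
theorem forall_rationalTateRepresentation_eq_iff (H : Subgroup G) (v : RationalTateModule A p) :
    (∀ g ∈ H, rationalTateRepresentation G A p g v = v) ↔
      ∃ w : ℚ_[p] ⊗[ℤ_[p]] TateModule (FixedPoints.addSubgroup H A) p,
        (((TateModule.map p (FixedPoints.addSubgroup H A).subtype).baseChange ℚ_[p] w
          : ℚ_[p] ⊗[ℤ_[p]] TateModule A p) : RationalTateModule A p) = v := by
  constructor
  · intro hv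
    obtain ⟨N, hN, x, hx⟩ := exists_smul_eq_toRational v
    have hN' : (N : ℚ_[p]) ≠ 0 := PadicInt.coe_ne_zero.mpr hN
    -- the lattice point `x` is fixed by `H`
    have hxfix : ∀ g ∈ H, g • x = x := fun g hg ↦ by
      apply TateModule.toRational_injective
      rw [← rationalTateRepresentation_toRational, ← hx, LinearMap.map_smul_of_tower, hv g hg]
    obtain ⟨y, hy⟩ := (TateModule.mem_range_map_fixedPoints_subtype_iff H x).mpr hxfix
    refine ⟨(N : ℚ_[p])⁻¹ • ((1 : ℚ_[p]) ⊗ₜ[ℤ_[p]] y), ?_⟩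
    rw [LinearMap.map_smul, LinearMap.baseChange_tmul, hy, ← TateModule.toRational_apply]
    change (N : ℚ_[p])⁻¹ • TateModule.toRational p x = v
    rw [← hx, smul_smul, inv_mul_cancel₀ hN', one_smul]
  · rintro ⟨w, rfl⟩ g hg
    exact rationalTateRepresentation_baseChange_map_fixedPoints H hg w

/-- **`dim_{ℚ_p} (V_p A)^H = rank_{ℤ_p} T_p(A^H)`** for `A[p]` finite (so that `T_p A` and
`T_p(A^H)` are free of finite rank, `TateModule.free_of_finite_torsionBy`): the base change of the
injection `T_p(A^H) ↪ T_p A` stays injective (`ℚ_p` is flat over `ℤ_p`) and has image exactly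
the `H`-invariants (`forall_rationalTateRepresentation_eq_iff`), and
`dim_{ℚ_p} V_p(A^H) = rank_{ℤ_p} T_p(A^H)` (`finrank_eq_of_finite_torsionBy`).  The invariants
are Mathlib's `Representation.invariants` of the restriction of `rationalTateRepresentation G A p`
to `H` (definitionally `ContinuousRep.fixedSubmodule`, see
`WeierstrassCurve.finrank_fixedSubmodule_rationalTate_eq`).  Silverman *ATAEC*, proof of
IV.10.2(a), PDF p. 359 (`dim V_ℓ(E)^{I} = dim V_ℓ(E(K^nr))`).
[cite: SilvermanATAEC1994, proof of Thm. IV.10.2(a), PDF p. 359] -/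
theorem finrank_invariants_rationalTateRepresentation (H : Subgroup G)
    (hfin : Finite (A[(p : ℕ)])) :
    Module.finrank ℚ_[p]
        (Representation.invariants ((rationalTateRepresentation G A p).comp H.subtype :
          Representation ℚ_[p] H (RationalTateModule A p))) =
      Module.finrank ℤ_[p] (TateModule (FixedPoints.addSubgroup H A) p) := by
  haveI := TateModule.free_of_finite_torsionBy hfin
  haveI : Module.Flat ℤ_[p] ℚ_[p] := IsLocalization.flat ℚ_[p] (nonZeroDivisors ℤ_[p])
  have hfin' : Finite ((FixedPoints.addSubgroup H A)[(p : ℕ)]) :=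
    finite_torsionBy_of_injective (FixedPoints.addSubgroup H A).subtype
      (fun _ _ h ↦ Subtype.ext h) _ hfin
  set Tι := TateModule.map p (FixedPoints.addSubgroup H A).subtype with hTι
  let Vι : RationalTateModule (FixedPoints.addSubgroup H A) p →ₗ[ℚ_[p]] RationalTateModule A p :=
    Tι.baseChange ℚ_[p]
  have hinj : Function.Injective Vι := by
    change Function.Injective (Tι.baseChange ℚ_[p])
    rw [LinearMap.baseChange_eq_ltensor]
    exact Module.Flat.lTensor_preserves_injective_linearMap _
      (TateModule.map_injective_of_injective _ Subtype.val_injective)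
  have hrange : LinearMap.range Vι =
      (Representation.invariants ((rationalTateRepresentation G A p).comp H.subtype :
          Representation ℚ_[p] H (RationalTateModule A p))) := by
    ext v
    rw [LinearMap.mem_range, Representation.mem_invariants]
    simp only [MonoidHom.coe_comp, Function.comp_apply, Subgroup.subtype_apply, Subtype.forall]
    exact (forall_rationalTateRepresentation_eq_iff H v).symm
  rw [← hrange, LinearMap.finrank_range_of_inj hinj]
  exact finrank_eq_of_finite_torsionBy hfin'

/-- `rank_{ℤ_p} T_p(A^H) ≤ dim_{ℚ_p} V_p A` for `A[p]` finite. [folklore] -/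
theorem finrank_tateModule_fixedPoints_le (H : Subgroup G) (hfin : Finite (A[(p : ℕ)])) :
    Module.finrank ℤ_[p] (TateModule (FixedPoints.addSubgroup H A) p) ≤
      Module.finrank ℚ_[p] (RationalTateModule A p) := by
  haveI := finite_of_finite_torsionBy hfin
  rw [← finrank_invariants_rationalTateRepresentation H hfin]
  exact Submodule.finrank_le _

end RationalTateModule

/-! ### Continuous Galois representations `V_ℓ M` -/

section Galois

variable {K : Type u} [Field K] (M : Type u) [AddCommGroup M]
  [DistribMulAction (absoluteGaloisGroup K) M] (ℓ : ℕ) [Fact ℓ.Prime]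

/-- For the continuous Galois representation `V_ℓ M` of a discrete `Γ_K`-module `M` with `M[ℓ]`
finite and any subgroup `H ≤ Γ_K`: `dim_{ℚ_ℓ} (V_ℓ M)^H = rank_{ℤ_ℓ} T_ℓ(M^H)`
(`ContinuousRep.fixedSubmodule` is definitionally the `Representation.invariants` of
`finrank_invariants_rationalTateRepresentation`).
[cite: SilvermanATAEC1994, proof of Thm. IV.10.2(a), PDF p. 359] -/
theorem finrank_fixedSubmodule_rationalTateGaloisRepOf
    (h : Continuous fun x : absoluteGaloisGroup K × RationalTateModule M ℓ ↦
      rationalTateRepresentation (absoluteGaloisGroup K) M ℓ x.1 x.2)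
    (H : Subgroup (absoluteGaloisGroup K)) (hfin : Finite (M[(ℓ : ℕ)])) :
    Module.finrank ℚ_[ℓ] ((rationalTateGaloisRepOf M ℓ h).fixedSubmodule H) =
      Module.finrank ℤ_[ℓ] (TateModule (FixedPoints.addSubgroup H M) ℓ) :=
  RationalTateModule.finrank_invariants_rationalTateRepresentation H hfin

/-- `codim (V_ℓ M)^H = dim V_ℓ M - rank T_ℓ(M^H)` for `M[ℓ]` finite.
[cite: SilvermanATAEC1994, proof of Thm. IV.10.2(a), PDF p. 359] -/
theorem codimFixed_rationalTateGaloisRepOf_eq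
    (h : Continuous fun x : absoluteGaloisGroup K × RationalTateModule M ℓ ↦
      rationalTateRepresentation (absoluteGaloisGroup K) M ℓ x.1 x.2)
    (H : Subgroup (absoluteGaloisGroup K)) (hfin : Finite (M[(ℓ : ℕ)])) :
    (rationalTateGaloisRepOf M ℓ h).codimFixed H =
      Module.finrank ℚ_[ℓ] (RationalTateModule M ℓ) -
        Module.finrank ℤ_[ℓ] (TateModule (FixedPoints.addSubgroup H M) ℓ) := by
  haveI := RationalTateModule.finite_of_finite_torsionBy hfin
  rw [GaloisRepresentations.ContinuousRep.codimFixed_eq_finrank_sub, finrank_fixedSubmodule_rationalTateGaloisRepOf M ℓ h H hfin]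

/-- `codim (V_ℓ M)^H = dim V_ℓ M` (no non-zero invariants) as soon as the `ℓ`-power torsion of
the fixed points `M^H` is finite (`M[ℓ]` finite).  Silverman *ATAEC* p. 359: *"`V_ℓ(A)` will be
`0` … if `A` is a finite group"*. [cite: SilvermanATAEC1994, proof of Thm. IV.10.2(a), PDF p. 359] -/
theorem codimFixed_rationalTateGaloisRepOf_eq_finrank_of_finite
    (h : Continuous fun x : absoluteGaloisGroup K × RationalTateModule M ℓ ↦
      rationalTateRepresentation (absoluteGaloisGroup K) M ℓ x.1 x.2)
    (H : Subgroup (absoluteGaloisGroup K)) (hfin : Finite (M[(ℓ : ℕ)]))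
    (htors : {a : FixedPoints.addSubgroup H M | ∃ n : ℕ, ℓ ^ n • a = 0}.Finite) :
    (rationalTateGaloisRepOf M ℓ h).codimFixed H = Module.finrank ℚ_[ℓ] (RationalTateModule M ℓ) := by
  rw [codimFixed_rationalTateGaloisRepOf_eq M ℓ h H hfin, TateModule.finrank_eq_zero_of_finite htors,
    Nat.sub_zero]

end Galois

end Literature.NumberTheory.EllipticCurves

/-! ### Elliptic curves: `codim (V_ℓ E)^H = 2 - rank T_ℓ(E(F̄)^H)` -/

namespace WeierstrassCurve

open Literature.NumberTheory.EllipticCurves Literature.NumberTheory.GaloisRepresentations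

variable {F : Type u} [Field F] (W : WeierstrassCurve F) (ℓ : ℕ) [Fact ℓ.Prime]

/-- For an elliptic curve `E/F`, a prime `ℓ` and a subgroup `H ≤ Γ_F`:
`dim_{ℚ_ℓ} (V_ℓ E)^H = rank_{ℤ_ℓ} T_ℓ(E(F̄)^H)` (`E(F̄)[ℓ]` is finite, `finite_geomTorsion_prime`).
Silverman *ATAEC*, proof of IV.10.2(a), PDF p. 359 (`H = I(K̄/K)`, `E(F̄)^H = E(K^nr)`).
[cite: SilvermanATAEC1994, proof of Thm. IV.10.2(a), PDF p. 359] -/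
theorem finrank_fixedSubmodule_rationalTate_eq [W.IsElliptic]
    (h : Continuous fun x : absoluteGaloisGroup F × RationalTateModule (geomPoints W) ℓ ↦
      rationalTateRepresentation (absoluteGaloisGroup F) (geomPoints W) ℓ x.1 x.2)
    (H : Subgroup (absoluteGaloisGroup F)) :
    Module.finrank ℚ_[ℓ] ((rationalTateGaloisRepOf (geomPoints W) ℓ h).fixedSubmodule H) =
      Module.finrank ℤ_[ℓ] (TateModule (FixedPoints.addSubgroup H (geomPoints W)) ℓ) :=
  finrank_fixedSubmodule_rationalTateGaloisRepOf (geomPoints W) ℓ h H (W.finite_geomTorsion_prime ℓ)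

/-- `rank_{ℤ_ℓ} T_ℓ(E(F̄)^H) ≤ 2` for `ℓ ≠ char F` (it is the dimension of a subspace of
`V_ℓ E ≅ ℚ_ℓ²`, `finrank_rationalTateModule_eq_two_holds`).
[cite: SilvermanAEC2009, Prop. III.7.1(a) with Remark 7.2] -/
theorem finrank_tateModule_fixedPoints_le_two [W.IsElliptic] (hℓ : (ℓ : F) ≠ 0)
    (H : Subgroup (absoluteGaloisGroup F)) :
    Module.finrank ℤ_[ℓ] (TateModule (FixedPoints.addSubgroup H (geomPoints W)) ℓ) ≤ 2 := by
  rw [← finrank_rationalTateModule_eq_two_holds W ℓ hℓ]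
  exact RationalTateModule.finrank_tateModule_fixedPoints_le H (W.finite_geomTorsion_prime ℓ)

/-- **Silverman *ATAEC* IV.10.2(a), the algebraic step**: for an elliptic curve `E/F`, a prime
`ℓ ≠ char F` and any subgroup `H ≤ Γ_F`, `codim_{ℚ_ℓ} (V_ℓ E)^H = 2 - rank_{ℤ_ℓ} T_ℓ(E(F̄)^H)`
(*"`ε(E/K) = 2 - dim_{ℚ_ℓ}(V_ℓ(E)^{I(K̄/K)})`"* together with
*"`V_ℓ(E(K^nr)) = V_ℓ(E(K̄))^{I(K̄/K)}`"*, PDF p. 359; the rank is `≤ 2`,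
`finrank_tateModule_fixedPoints_le_two`).
[cite: SilvermanATAEC1994, proof of Thm. IV.10.2(a), PDF p. 359] -/
theorem codimFixed_rationalTate_eq_two_sub [W.IsElliptic] (hℓ : (ℓ : F) ≠ 0)
    (h : Continuous fun x : absoluteGaloisGroup F × RationalTateModule (geomPoints W) ℓ ↦
      rationalTateRepresentation (absoluteGaloisGroup F) (geomPoints W) ℓ x.1 x.2)
    (H : Subgroup (absoluteGaloisGroup F)) :
    (rationalTateGaloisRepOf (geomPoints W) ℓ h).codimFixed H =
      2 - Module.finrank ℤ_[ℓ] (TateModule (FixedPoints.addSubgroup H (geomPoints W)) ℓ) := by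
  rw [codimFixed_rationalTateGaloisRepOf_eq (geomPoints W) ℓ h H (W.finite_geomTorsion_prime ℓ)]
  change Module.finrank ℚ_[ℓ] (W.rationalTateModule ℓ) - _ = _
  rw [finrank_rationalTateModule_eq_two_holds W ℓ hℓ]

/-- **Additive shape.**  For an elliptic curve `E/F`, `ℓ ≠ char F` and `H ≤ Γ_F`: if the `ℓ`-power
torsion of `E(F̄)^H` is finite, then `(V_ℓ E)^H = 0`, i.e. `codim (V_ℓ E)^H = 2`.  With `F = K` a
number field and `H = I_𝔓` this is the additive case of Silverman *ATAEC* IV.10.2(a) granted its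
geometric input `#E(K_v^nr)[ℓ^∞] < ∞` (`E(K^nr)/E₀(K^nr)` finite, IV.9.2(d); `E₀(K^nr)` has no
`ℓ`-torsion for additive reduction, AEC VII.3.1 and VII.5.1(c)).
[cite: SilvermanATAEC1994, proof of Thm. IV.10.2(a), PDF p. 359] -/
theorem codimFixed_rationalTate_eq_two_of_finite [W.IsElliptic] (hℓ : (ℓ : F) ≠ 0)
    (h : Continuous fun x : absoluteGaloisGroup F × RationalTateModule (geomPoints W) ℓ ↦
      rationalTateRepresentation (absoluteGaloisGroup F) (geomPoints W) ℓ x.1 x.2)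
    (H : Subgroup (absoluteGaloisGroup F))
    (htors : {P : FixedPoints.addSubgroup H (geomPoints W) | ∃ n : ℕ, ℓ ^ n • P = 0}.Finite) :
    (rationalTateGaloisRepOf (geomPoints W) ℓ h).codimFixed H = 2 := by
  rw [W.codimFixed_rationalTate_eq_two_sub ℓ hℓ h H, TateModule.finrank_eq_zero_of_finite htors]

/-- **Multiplicative shape.**  For an elliptic curve `E/F`, `ℓ ≠ char F` and `H ≤ Γ_F`:
`codim (V_ℓ E)^H = 1 ↔ rank_{ℤ_ℓ} T_ℓ(E(F̄)^H) = 1`.  With `F = K` a number field and `H = I_𝔓`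
this is the multiplicative case of Silverman *ATAEC* IV.10.2(a) granted its geometric input
`V_ℓ(E(K^nr)) ≅ V_ℓ(k̄^*) ≅ ℚ_ℓ` (PDF p. 359).
[cite: SilvermanATAEC1994, proof of Thm. IV.10.2(a), PDF p. 359] -/
theorem codimFixed_rationalTate_eq_one_iff [W.IsElliptic] (hℓ : (ℓ : F) ≠ 0)
    (h : Continuous fun x : absoluteGaloisGroup F × RationalTateModule (geomPoints W) ℓ ↦
      rationalTateRepresentation (absoluteGaloisGroup F) (geomPoints W) ℓ x.1 x.2)
    (H : Subgroup (absoluteGaloisGroup F)) :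
    (rationalTateGaloisRepOf (geomPoints W) ℓ h).codimFixed H = 1 ↔
      Module.finrank ℤ_[ℓ] (TateModule (FixedPoints.addSubgroup H (geomPoints W)) ℓ) = 1 := by
  rw [W.codimFixed_rationalTate_eq_two_sub ℓ hℓ h H]
  have := W.finrank_tateModule_fixedPoints_le_two ℓ hℓ H
  omega

/-- **Good shape.**  `codim (V_ℓ E)^H = 0 ↔ rank_{ℤ_ℓ} T_ℓ(E(F̄)^H) = 2` (`ℓ ≠ char F`).
[cite: SilvermanATAEC1994, proof of Thm. IV.10.2(a), PDF p. 359] -/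
theorem codimFixed_rationalTate_eq_zero_iff [W.IsElliptic] (hℓ : (ℓ : F) ≠ 0)
    (h : Continuous fun x : absoluteGaloisGroup F × RationalTateModule (geomPoints W) ℓ ↦
      rationalTateRepresentation (absoluteGaloisGroup F) (geomPoints W) ℓ x.1 x.2)
    (H : Subgroup (absoluteGaloisGroup F)) :
    (rationalTateGaloisRepOf (geomPoints W) ℓ h).codimFixed H = 0 ↔
      Module.finrank ℤ_[ℓ] (TateModule (FixedPoints.addSubgroup H (geomPoints W)) ℓ) = 2 := by
  rw [W.codimFixed_rationalTate_eq_two_sub ℓ hℓ h H]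
  have := W.finrank_tateModule_fixedPoints_le_two ℓ hℓ H
  omega

section NumberField

variable {K : Type u} [Field K] [NumberField K] (W : WeierstrassCurve K) (ℓ : ℕ) [Fact ℓ.Prime]

/-- **Reduction of the additive case of *ATAEC* IV.10.2(a) to its geometric input.**  For an
elliptic curve `E/K` over a number field, a prime `ℓ` and a prime `𝔓` of `\bar ℤ_K` with inertia
group `I_𝔓 ≤ Γ_K`: if the `ℓ`-power torsion of `E(K̄)^{I_𝔓}` is finite, then
`codim_{ℚ_ℓ} (V_ℓ E)^{I_𝔓} = 2` — the conclusion of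
`WeierstrassCurve.codimFixed_inertia_rationalTate_eq_two_of_hasAdditiveReductionAt`
(`HasseWeilAbelianConductor`).  At a place `v ∤ ℓ` of additive reduction below `𝔓` the hypothesis
is Silverman's `V_ℓ(E(K^nr)) = 0` input: `E(K̄)^{I_𝔓}[ℓ^∞] = E(K_v^nr)[ℓ^∞]` injects into the finite
group `E(K_v^nr)/E₀(K_v^nr)` (IV.9.2(d)), since `E₀(K_v^nr)` has no `ℓ`-torsion
(`E₁` by AEC VII.3.1, `E₀/E₁ ≅ k̄⁺` by VII.5.1(c)).
[cite: SilvermanATAEC1994, proof of Thm. IV.10.2(a), PDF p. 359] -/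
theorem codimFixed_inertia_rationalTate_eq_two_of_finite [W.IsElliptic]
    (h : Continuous fun x : absoluteGaloisGroup K × RationalTateModule (geomPoints W) ℓ ↦
      rationalTateRepresentation (absoluteGaloisGroup K) (geomPoints W) ℓ x.1 x.2)
    (𝔓 : Ideal (absIntegers (𝓞 K) K))
    (htors : {P : FixedPoints.addSubgroup (𝔓.inertia (absoluteGaloisGroup K)) (geomPoints W) |
        ∃ n : ℕ, ℓ ^ n • P = 0}.Finite) :
    (rationalTateGaloisRepOf (geomPoints W) ℓ h).codimFixed (𝔓.inertia (absoluteGaloisGroup K)) =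
      2 :=
  W.codimFixed_rationalTate_eq_two_of_finite ℓ
    (by exact_mod_cast (Fact.out : ℓ.Prime).ne_zero) h _ htors

/-- **Reduction of the multiplicative case of *ATAEC* IV.10.2(a) to its geometric input.**  For
an elliptic curve `E/K` over a number field, a prime `ℓ` and a prime `𝔓` of `\bar ℤ_K`: if
`rank_{ℤ_ℓ} T_ℓ(E(K̄)^{I_𝔓}) = 1` then `codim_{ℚ_ℓ} (V_ℓ E)^{I_𝔓} = 1` — the conclusion of
`WeierstrassCurve.codimFixed_inertia_rationalTate_eq_one_of_hasMultiplicativeReductionAt`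
(`HasseWeilAbelianConductor`).  At a place `v ∤ ℓ` of multiplicative reduction below `𝔓` the
hypothesis is Silverman's `V_ℓ(E(K^nr)) ≅ V_ℓ(E₀(K^nr)) ≅ V_ℓ(Ẽ_ns(k̄)) = V_ℓ(k̄^*) ≅ ℚ_ℓ`
(IV.9.2(d), AEC VII.3.1, VII.5.1(b)).
[cite: SilvermanATAEC1994, proof of Thm. IV.10.2(a), PDF p. 359] -/
theorem codimFixed_inertia_rationalTate_eq_one_of_finrank_eq_one [W.IsElliptic]
    (h : Continuous fun x : absoluteGaloisGroup K × RationalTateModule (geomPoints W) ℓ ↦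
      rationalTateRepresentation (absoluteGaloisGroup K) (geomPoints W) ℓ x.1 x.2)
    (𝔓 : Ideal (absIntegers (𝓞 K) K))
    (hrank : Module.finrank ℤ_[ℓ]
        (TateModule (FixedPoints.addSubgroup (𝔓.inertia (absoluteGaloisGroup K)) (geomPoints W)) ℓ)
      = 1) :
    (rationalTateGaloisRepOf (geomPoints W) ℓ h).codimFixed (𝔓.inertia (absoluteGaloisGroup K)) =
      1 :=
  (W.codimFixed_rationalTate_eq_one_iff ℓ (by exact_mod_cast (Fact.out : ℓ.Prime).ne_zero) h _).mpr
    hrank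

end NumberField

end WeierstrassCurve
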